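import Summits.CriticalPhenomena.SAWScalingLimit.Theorems.MassRatio.Negative.FjordA

/-!
# Crux `MassRatio` (stmt-CriticalPhenomena-8550) — load-bearing hypotheses, part 8: the fjord family: a SAW, inside, exhaustion, `b₂ → b`; the staircase comparison walk into `Kbox` (`e₀`, `stairWalk`); `Λ₂_violates`; **`massRatio_false_without_rows`**, **`massRatio_false_without_rho_pos`** (the rows clause and `0 < ρ` are load-bearing)

Negative knowledge on the crux `MassRatio` (stmt-CriticalPhenomena-8550, route SAWDefectDecoherence r3),
written by the standing disprover (cdisprove, cycles 1–4). The series `MassRatio/Negative/*` does NOT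
refute the crux (verdict: RESISTS — it is a pure exponent bet, predicted ratio `δ^{-25/48}` against the
cut `δ^{-3/4}`); it proves which hypotheses of the crux are LOAD-BEARING (rows clause, `0 < ρ`,
`δ·mid(b_δ) → b`, exhaustion of compacts: each deleted ⇒ FALSE, by explicit admissible families in the
rectangle `D₀ = (-2,2)×(-1,1)` whose boundary mass at the target edge is starved EXACTLY by a bare
corridor), that the hypothesis frame is satisfiable (`massRatio_frame_nonvacuous`), and that the
`Nonempty`-SAW clause is implied by the others. Mechanism throughout: on a bare root-attached corridor
the self-avoiding walk is unique, so `|Z| = x_c^{length}` exactly, while a staircase walk certifies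
`|Z(e₀)| ≥ x_c^{2 iK + 1}` at a mid-edge `e₀` of the compact `Kbox`; `x_c < 3/5` and Bernoulli finish.
-/

namespace Summit.CriticalPhenomena.SAWScalingLimit.Theorems.MassRatio.Negative

open Literature.Probability.LatticeModels Literature.Probability.RandomPlanarGeometry.SAW
open Literature.Probability.RandomPlanarGeometry
open Summit.CriticalPhenomena.SAWScalingLimit.Theses.SAWDefectDecoherence

section FjordFamily

variable {δ : ℝ}

/-- `nonempty_saw_Λ₂`: fjord-family (`Λ₂`) lemma (MassRatio negative series). [folklore] -/
theorem nonempty_saw_Λ₂ (hδ : 0 < δ) (hδ1 : δ ≤ 1 / 100) :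
    Nonempty (HexMidEdgeSAW (Λ₂ δ) (aE δ) (b₂ δ)) := by
  obtain ⟨-, hM0, hm10, hPa, hpa, hpb, hbP, hP100, -⟩ := params hδ hδ1
  have hL := L₂_eq hδ hδ1
  rw [aE_eq, b₂_eq hδ hδ1]
  refine ⟨corridorWalk (Λ := Λ₂ δ) (c := corr δ) (L := L₂ δ) ?_ ?_ ?_
    (by unfold corr; simpa using adj_aE δ) ?_ ?_ ?_⟩
  · intro i hi; unfold corr; rw [bv_mem_Λ₂ hδ hδ1]; omega
  · intro i j _ _ h; unfold corr at h; have := (bv_inj h).2; omega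
  · intro i _; unfold corr; rw [adj_bv_iff]; left; exact ⟨rfl, Or.inl (by push_cast; ring)⟩
  · rw [bv_mem_Λ₂ hδ hδ1]; omega
  · rw [bv_mem_Λ₂ hδ hδ1]; omega
  · intro h
    unfold corr at h
    rcases Sym2.eq_iff.1 h with ⟨h1, -⟩ | ⟨h1, -⟩
    · have := (bv_inj h1).1; omega
    · have := (bv_inj h1).1; omega

/-- `inside_Λ₂`: fjord-family (`Λ₂`) lemma (MassRatio negative series). [folklore] -/
theorem inside_Λ₂ (hδ : 0 < δ) (hδ1 : δ ≤ 1 / 100) :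
    ∀ v ∈ Λ₂ δ, (δ : ℂ) * hexCenter v ∈ D₀.carrier :=
  fun v hv => inside_ΛR hδ hδ1 v (Λ₂_subset δ hv)

/-- `exhaust_Λ₂`: fjord-family (`Λ₂`) lemma (MassRatio negative series). [folklore] -/
theorem exhaust_Λ₂ {K : Set ℂ} (hK : IsCompact K) (hKD : K ⊆ D₀.carrier) :
    ∀ᶠ δ : ℝ in nhdsWithin 0 (Set.Ioi 0), ∀ v : HexVertex, (δ : ℂ) * hexCenter v ∈ K →
      v ∈ Λ₂ δ := by
  filter_upwards [exhaust_rows hK hKD, Ioo_mem_nhdsGT (show (0:ℝ) < 1 / 100 by norm_num)]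
    with δ hδ hδ' v hv
  obtain ⟨h1, h2, h3, h4⟩ := hδ v hv
  rw [← bv_row_pos v, bv_mem_Λ₂ hδ'.1 hδ'.2.le]
  exact Or.inl ⟨h1, h2, h3, h4⟩

/-- `scaled_b₂`: fjord-family (`Λ₂`) lemma (MassRatio negative series). [folklore] -/
theorem scaled_b₂ (δ : ℝ) : (δ : ℂ) * hexMidpoint (b₂ δ) =
    ⟨δ * (2 * (pB δ : ℝ) + 1) / 4, δ * hgt * ((mRow δ : ℝ) + 1 / 2)⟩ := by
  have hodd : (pB δ - 1 - mRow δ) % 2 = 1 := by have := pB_mod δ; omega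
  apply Complex.ext
  · rw [Complex.re_ofReal_mul, b₂, mid_re, pos_bv, pos_bv]; simp; ring
  · rw [Complex.im_ofReal_mul, b₂, mid_im, im_center_bv_odd hodd, im_center_bv_even (pB_mod δ)]
    simp; ring

/-- `tendsto_b₂`: fjord-family (`Λ₂`) lemma (MassRatio negative series). [folklore] -/
theorem tendsto_b₂ : Filter.Tendsto (fun δ : ℝ => (δ : ℂ) * hexMidpoint (b₂ δ))
    (nhdsWithin 0 (Set.Ioi 0)) (nhds (D₀.pt 1)) := by
  rw [D₀_pt1, tendsto_iff_dist_tendsto_zero]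
  refine squeeze_zero' (Filter.Eventually.of_forall fun δ => dist_nonneg) ?_ (tendsto_cmul 4)
  filter_upwards [self_mem_nhdsWithin] with δ hδ
  rw [Set.mem_Ioi] at hδ
  rw [scaled_b₂, Complex.dist_eq]
  refine (Complex.norm_le_abs_re_add_abs_im _).trans ?_
  simp only [Complex.sub_re, Complex.sub_im]
  obtain ⟨h1, h2⟩ := pB_re hδ
  have h3 := mRow_height hδ
  have h4 := mRow_height' hδ
  have hg := hgt_pos
  have hg' := hgt_lt
  have k1 : δ * hgt ≤ δ := by nlinarith
  have e1 : |δ * (2 * (pB δ : ℝ) + 1) / 4 - 1| ≤ 2 * δ := abs_le.2 ⟨by linarith, by linarith⟩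
  have e2 : |δ * hgt * ((mRow δ : ℝ) + 1 / 2) - -1| ≤ 2 * δ := abs_le.2 ⟨by nlinarith, by nlinarith⟩
  linarith

/-! ### The comparison walk: the staircase from the root into `Kbox` -/

/-- `stair_zero`: fjord-family (`Λ₂`) lemma (MassRatio negative series). [folklore] -/
theorem stair_zero (δ : ℝ) : stair δ 0 = bv (mRow δ) (pA δ) := by simp [stair]

/-- `adj_stair`: fjord-family (`Λ₂`) lemma (MassRatio negative series). [folklore] -/
theorem adj_stair (δ : ℝ) (j : ℕ) : hexGraph.Adj (stair δ j) (stair δ (j + 1)) := by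
  have hmod := pA_mod δ
  unfold stair
  rw [adj_bv_iff]
  rcases Nat.even_or_odd j with ⟨t, rfl⟩ | ⟨t, rfl⟩
  · left
    refine ⟨by congr 1; omega, Or.inr ?_⟩
    have e1 : ((t + t + 1) / 2 : ℕ) = t := by omega
    have e2 : ((t + t + 1 + 1) / 2 : ℕ) = t + 1 := by omega
    rw [e1, e2]; push_cast; ring
  · right; right
    have e1 : ((2 * t + 1 + 1) / 2 : ℕ) = t + 1 := by omega
    have e2 : ((2 * t + 1 + 1 + 1) / 2 : ℕ) = t + 1 := by omega
    have e3 : ((2 * t + 1) / 2 : ℕ) = t := by omega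
    have e4 : ((2 * t + 1 + 1) / 2 : ℕ) = t + 1 := by omega
    refine ⟨by rw [e1, e2], by rw [e3, e4]; push_cast; ring, ?_⟩
    rw [e1, e3]; push_cast; omega

/-- `stair_inj`: fjord-family (`Λ₂`) lemma (MassRatio negative series). [folklore] -/
theorem stair_inj (δ : ℝ) {i j : ℕ} (h : stair δ i = stair δ j) : i = j := by
  unfold stair at h
  obtain ⟨h1, h2⟩ := bv_inj h
  omega

/-- `stair_mem`: fjord-family (`Λ₂`) lemma (MassRatio negative series). [folklore] -/
theorem stair_mem (hδ : 0 < δ) (hδ1 : δ ≤ 1 / 100) {j : ℕ} (hj : j ≤ 2 * iK δ + 1) :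
    stair δ j ∈ Λ₂ δ := by
  obtain ⟨hiM, hM0, hm10, hPa, hpa, hpb, hbP, hP100, -⟩ := params hδ hδ1
  unfold stair
  rw [bv_mem_Λ₂ hδ hδ1]
  rcases Nat.lt_or_ge j 6 with h6 | h6
  · interval_cases j <;> simp <;> omega
  · left; omega

/-- the target mid-edge of the staircase walk [folklore] -/
noncomputable def e₀ (δ : ℝ) : Sym2 HexVertex := s(stair δ (2 * iK δ), stair δ (2 * iK δ + 1))

/-- The staircase walk from `a_δ` with `2 iK + 1` vertices, ending on the mid-edge
`e₀ = {S_{2iK}, S_{2iK+1}}`, in any domain `Λ` containing the staircase. [folklore] -/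
noncomputable def stairWalkIn (Λ : Finset HexVertex) (hmem : ∀ j, j ≤ 2 * iK δ + 1 → stair δ j ∈ Λ) :
    HexMidEdgeSAW Λ (aE δ) (e₀ δ) :=
  mkSAW Λ (bv (mRow δ - 1) (pA δ)) (bv (mRow δ) (pA δ)) (e₀ δ)
    ((List.range (2 * iK δ + 1)).map (stair δ)) (by simp)
    (by
      intro v hv
      simp only [List.mem_map, List.mem_range] at hv
      obtain ⟨j, hj, rfl⟩ := hv
      exact hmem j (by omega))
    (by
      refine List.Nodup.map_on ?_ List.nodup_range
      intro i _ j _ h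
      exact stair_inj δ h)
    (by
      refine List.isChain_iff_getElem.2 ?_
      intro i hi
      simp only [List.getElem_map, List.getElem_range]
      exact adj_stair δ i)
    (by simp [List.range_succ_eq_map, stair_zero])
    (by
      rw [List.getLast_eq_getElem, e₀]
      simp [List.getElem_map, List.getElem_range])
    (adj_aE δ)
    (by rw [← stair_zero]; exact hmem 0 (by omega))
    (by
      simp only [List.mem_map, List.mem_range, not_exists, not_and]
      intro j _ h
      unfold stair at h
      have := (bv_inj h).1; omega)
    ⟨stair δ (2 * iK δ + 1), by rw [e₀]; exact Sym2.mem_mk_right _ _, by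
      simp only [List.mem_map, List.mem_range, not_exists, not_and]
      intro j hj h
      have := stair_inj δ h; omega⟩
    (by
      intro h
      rw [e₀] at h
      rcases Sym2.eq_iff.1 h with ⟨h1, -⟩ | ⟨h1, -⟩
      · unfold stair at h1; have := (bv_inj h1).1; omega
      · unfold stair at h1; have := (bv_inj h1).1; omega)

/-- `stairWalkIn_length`: fjord-family (`Λ₂`) lemma (MassRatio negative series). [folklore] -/
theorem stairWalkIn_length (Λ : Finset HexVertex) (hmem : ∀ j, j ≤ 2 * iK δ + 1 → stair δ j ∈ Λ) :
    (stairWalkIn Λ hmem).length = 2 * iK δ + 1 := by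
  show (List.map (stair δ) (List.range (2 * iK δ + 1))).length = 2 * iK δ + 1
  simp

/-- the staircase walk in the fjord family [folklore] -/
noncomputable def stairWalk (hδ : 0 < δ) (hδ1 : δ ≤ 1 / 100) : HexMidEdgeSAW (Λ₂ δ) (aE δ) (e₀ δ) :=
  stairWalkIn (Λ₂ δ) fun _ hj => stair_mem hδ hδ1 hj

/-- `stairWalk_length`: fjord-family (`Λ₂`) lemma (MassRatio negative series). [folklore] -/
theorem stairWalk_length (hδ : 0 < δ) (hδ1 : δ ≤ 1 / 100) :
    (stairWalk hδ hδ1).length = 2 * iK δ + 1 :=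
  stairWalkIn_length _ _

/-- `e₀_mem_of`: fjord-family (`Λ₂`) lemma (MassRatio negative series). [folklore] -/
theorem e₀_mem_of {Λ : Finset HexVertex} (h : stair δ (2 * iK δ) ∈ Λ) : e₀ δ ∈ hexDomainMidEdges Λ :=
  ⟨(SimpleGraph.mem_edgeSet _).2 (adj_stair δ _), stair δ (2 * iK δ), Sym2.mem_mk_left _ _, h⟩

/-- `e₀_mem`: fjord-family (`Λ₂`) lemma (MassRatio negative series). [folklore] -/
theorem e₀_mem (hδ : 0 < δ) (hδ1 : δ ≤ 1 / 100) : e₀ δ ∈ hexDomainMidEdges (Λ₂ δ) :=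
  e₀_mem_of (stair_mem hδ hδ1 (by omega))

/-- `stair_even`: fjord-family (`Λ₂`) lemma (MassRatio negative series). [folklore] -/
theorem stair_even (δ : ℝ) : stair δ (2 * iK δ) = bv (mRow δ + iK δ) (pA δ - iK δ) := by
  unfold stair; congr 2 <;> omega

/-- `stair_odd`: fjord-family (`Λ₂`) lemma (MassRatio negative series). [folklore] -/
theorem stair_odd (δ : ℝ) : stair δ (2 * iK δ + 1) = bv (mRow δ + iK δ) (pA δ - iK δ - 1) := by
  unfold stair; congr 1 <;> omega

/-- `scaled_e₀`: fjord-family (`Λ₂`) lemma (MassRatio negative series). [folklore] -/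
theorem scaled_e₀ (δ : ℝ) : (δ : ℂ) * hexMidpoint (e₀ δ) =
    ⟨δ * (2 * (pA δ : ℝ) - 2 * (iK δ : ℝ) + 1) / 4,
      δ * hgt * ((mRow δ : ℝ) + (iK δ : ℝ) + 1 / 2)⟩ := by
  have hmod := pA_mod δ
  have heven : (pA δ - iK δ - (mRow δ + iK δ)) % 2 = 0 := by omega
  have hodd : (pA δ - iK δ - 1 - (mRow δ + iK δ)) % 2 = 1 := by omega
  rw [e₀, stair_even, stair_odd]
  apply Complex.ext
  · rw [Complex.re_ofReal_mul, mid_re, pos_bv, pos_bv]; simp; ring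
  · rw [Complex.im_ofReal_mul, mid_im, im_center_bv_even heven, im_center_bv_odd hodd]
    simp; ring

/-- `e₀_mem_Kbox`: fjord-family (`Λ₂`) lemma (MassRatio negative series). [folklore] -/
theorem e₀_mem_Kbox (hδ : 0 < δ) (hδ1 : δ ≤ 1 / 100) : (δ : ℂ) * hexMidpoint (e₀ δ) ∈ Kbox := by
  rw [scaled_e₀, mem_Kbox]
  simp only
  obtain ⟨h1, h2⟩ := pA_re hδ
  have h3 := mRow_height hδ
  have h4 := mRow_height' hδ
  have h5 := iK_le hδ
  have h6 := lt_iK hδ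
  have hg := hgt_pos
  have hg' := hgt_lt
  have hg'' := hgt_gt
  have hik0 : (0:ℝ) ≤ iK δ := by positivity
  have k1 : δ * hgt ≤ δ := by nlinarith
  -- `0 ≤ δ iK ≤ 1/2`
  have k2 : 0 ≤ δ * (iK δ : ℝ) := by positivity
  have k3 : δ * (iK δ : ℝ) ≤ 1 / 2 := by nlinarith
  refine ⟨⟨by nlinarith, by nlinarith⟩, by nlinarith, by nlinarith⟩

/-- **THE CORE COMPARISON (fjord family).** For the compact `Kbox`, no constant `C` bounds the
`K`-averaged bulk mass by `C δ^{-3/4}` times the mass at the starved tip `b'_δ`. [folklore] -/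
theorem Λ₂_violates (C : ℝ) :
    ¬ (∀ᶠ δ : ℝ in nhdsWithin 0 (Set.Ioi 0),
      δ ^ 2 * (∑ᶠ e ∈ {e : Sym2 HexVertex | e ∈ hexDomainMidEdges (Λ₂ δ) ∧
        (δ : ℂ) * hexMidpoint e ∈ Kbox},
        ‖hexParafermionicObservable (Λ₂ δ) (aE δ) hexCriticalFugacity 0 e‖) ≤
      C * δ ^ (-(3 : ℝ) / 4) *
        ‖hexParafermionicObservable (Λ₂ δ) (aE δ) hexCriticalFugacity 0 (b₂ δ)‖) := by
  intro hev
  have hx0 := hexCriticalFugacity_pos_lt_one.1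
  refine endgame hx0 xc_lt.le C (fun δ => 2 * iK δ + 1) (fun δ => L₂ δ - 2 * iK δ)
    (fun δ => iK δ / 2) ?_ ?_
  · filter_upwards [hev, Ioo_mem_nhdsGT (show (0:ℝ) < 1 / 100 by norm_num)] with δ hδ hδ'
    have hδ0 := hδ'.1
    have hδ1 : δ ≤ 1 / 100 := hδ'.2.le
    obtain ⟨-, -, -, -, hpa, hpb, -, -, hN, -⟩ := params hδ0 hδ1
    have hL := L₂_eq hδ0 hδ1
    -- the left-hand side dominates `δ² x^{2 iK + 1}`
    have hE : ({e : Sym2 HexVertex | e ∈ hexDomainMidEdges (Λ₂ δ) ∧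
        (δ : ℂ) * hexMidpoint e ∈ Kbox}).Finite :=
      (hexDomainMidEdges_finite (Λ₂ δ)).subset fun e he => he.1
    have hterm := term_le_finsum_mem hE (f := fun e =>
      ‖hexParafermionicObservable (Λ₂ δ) (aE δ) hexCriticalFugacity 0 e‖) (fun e => norm_nonneg _)
      ⟨e₀_mem hδ0 hδ1, e₀_mem_Kbox hδ0 hδ1⟩
    have hwalk := pow_length_le_norm_Z (Λ₂ δ) (aE δ) (e₀ δ) (stairWalk hδ0 hδ1) hx0.le
    rw [stairWalk_length] at hwalk
    have hlhs : δ ^ 2 * hexCriticalFugacity ^ (2 * iK δ + 1) ≤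
        δ ^ 2 * (∑ᶠ e ∈ {e : Sym2 HexVertex | e ∈ hexDomainMidEdges (Λ₂ δ) ∧
          (δ : ℂ) * hexMidpoint e ∈ Kbox},
          ‖hexParafermionicObservable (Λ₂ δ) (aE δ) hexCriticalFugacity 0 e‖) :=
      mul_le_mul_of_nonneg_left (hwalk.trans hterm) (by positivity)
    -- the right-hand side is `C δ^{-3/4} x^{L₂ + 1}`
    rw [norm_Z_b₂ hδ0 hδ1] at hδ
    have hexp : L₂ δ + 1 = 2 * iK δ + 1 + (L₂ δ - 2 * iK δ) := by omega
    rw [hexp] at hδ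
    exact hlhs.trans hδ
  · filter_upwards [Ioo_mem_nhdsGT (show (0:ℝ) < 1 / 100 by norm_num)] with δ hδ'
    have hδ0 := hδ'.1
    have hδ1 : δ ≤ 1 / 100 := hδ'.2.le
    obtain ⟨-, -, -, -, hpa, hpb, -, -, hN, -, hn⟩ := params hδ0 hδ1
    have hL := L₂_eq hδ0 hδ1
    refine ⟨by omega, hn⟩

/-! ### `MassRatio` without the rows clause / without `0 < ρ` is FALSE -/

/-- `MassRatio` with the rows conjunct (and its binder `m`) DELETED, everything else verbatim. [folklore] -/
def MassRatioWithoutRows : Prop :=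
  ∀ (D : Literature.Probability.RandomPlanarGeometry.DobrushinDomain) (ρ : ℝ)
    (Λ : ℝ → Finset HexVertex) (a b : ℝ → Sym2 HexVertex),
  let Z : ℝ → Sym2 HexVertex → ℂ := fun δ z =>
    hexParafermionicObservable (Λ δ) (a δ) hexCriticalFugacity 0 z;
  0 < ρ → D.carrier ∩ Metric.ball (D.pt 1) ρ = {z : ℂ | (D.pt 1).im < z.im} ∩ Metric.ball (D.pt 1) ρ →
  (∀ᶠ δ : ℝ in nhdsWithin 0 (Set.Ioi 0), hexDomainSimplyConnected (Λ δ) ∧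
    a δ ∈ hexDomainBoundary (Λ δ) ∧ b δ ∈ hexDomainBoundary (Λ δ) ∧
    Nonempty (HexMidEdgeSAW (Λ δ) (a δ) (b δ)) ∧
    (hexGraph.induce ((Λ δ : Finset HexVertex) : Set HexVertex)).Preconnected ∧
    (∀ v ∈ Λ δ, (δ : ℂ) * hexCenter v ∈ D.carrier)) →
  (∀ K : Set ℂ, IsCompact K → K ⊆ D.carrier → ∀ᶠ δ : ℝ in nhdsWithin 0 (Set.Ioi 0),
    ∀ v : HexVertex, (δ : ℂ) * hexCenter v ∈ K → v ∈ Λ δ) →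
  Filter.Tendsto (fun δ : ℝ => (δ : ℂ) * hexMidpoint (a δ)) (nhdsWithin 0 (Set.Ioi 0)) (nhds (D.pt 0)) →
  Filter.Tendsto (fun δ : ℝ => (δ : ℂ) * hexMidpoint (b δ)) (nhdsWithin 0 (Set.Ioi 0)) (nhds (D.pt 1)) →
  ∀ K : Set ℂ, IsCompact K → K ⊆ D.carrier → ∃ C : ℝ, ∀ᶠ δ : ℝ in nhdsWithin 0 (Set.Ioi 0),
    δ ^ 2 * (∑ᶠ e ∈ {e : Sym2 HexVertex | e ∈ hexDomainMidEdges (Λ δ) ∧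
      (δ : ℂ) * hexMidpoint e ∈ K}, ‖Z δ e‖) ≤ C * δ ^ (-(3 : ℝ) / 4) * ‖Z δ (b δ)‖

/-- `MassRatio` with ONLY the hypothesis `0 < ρ` deleted (flatness and rows clause kept verbatim). [folklore] -/
def MassRatioWithoutRhoPos : Prop :=
  ∀ (D : Literature.Probability.RandomPlanarGeometry.DobrushinDomain) (ρ : ℝ)
    (Λ : ℝ → Finset HexVertex) (m : ℝ → ℤ) (a b : ℝ → Sym2 HexVertex),
  let Z : ℝ → Sym2 HexVertex → ℂ := fun δ z =>
    hexParafermionicObservable (Λ δ) (a δ) hexCriticalFugacity 0 z;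
  D.carrier ∩ Metric.ball (D.pt 1) ρ = {z : ℂ | (D.pt 1).im < z.im} ∩ Metric.ball (D.pt 1) ρ →
  (∀ᶠ δ : ℝ in nhdsWithin 0 (Set.Ioi 0), hexDomainSimplyConnected (Λ δ) ∧
    a δ ∈ hexDomainBoundary (Λ δ) ∧ b δ ∈ hexDomainBoundary (Λ δ) ∧
    Nonempty (HexMidEdgeSAW (Λ δ) (a δ) (b δ)) ∧
    (hexGraph.induce ((Λ δ : Finset HexVertex) : Set HexVertex)).Preconnected ∧
    (∀ v ∈ Λ δ, (δ : ℂ) * hexCenter v ∈ D.carrier) ∧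
    (∀ v : HexVertex, (δ : ℂ) * hexCenter v ∈ Metric.ball (D.pt 1) ρ → (v ∈ Λ δ ↔ m δ ≤ v.1 1))) →
  (∀ K : Set ℂ, IsCompact K → K ⊆ D.carrier → ∀ᶠ δ : ℝ in nhdsWithin 0 (Set.Ioi 0),
    ∀ v : HexVertex, (δ : ℂ) * hexCenter v ∈ K → v ∈ Λ δ) →
  Filter.Tendsto (fun δ : ℝ => (δ : ℂ) * hexMidpoint (a δ)) (nhdsWithin 0 (Set.Ioi 0)) (nhds (D.pt 0)) →
  Filter.Tendsto (fun δ : ℝ => (δ : ℂ) * hexMidpoint (b δ)) (nhdsWithin 0 (Set.Ioi 0)) (nhds (D.pt 1)) →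
  ∀ K : Set ℂ, IsCompact K → K ⊆ D.carrier → ∃ C : ℝ, ∀ᶠ δ : ℝ in nhdsWithin 0 (Set.Ioi 0),
    δ ^ 2 * (∑ᶠ e ∈ {e : Sym2 HexVertex | e ∈ hexDomainMidEdges (Λ δ) ∧
      (δ : ℂ) * hexMidpoint e ∈ K}, ‖Z δ e‖) ≤ C * δ ^ (-(3 : ℝ) / 4) * ‖Z δ (b δ)‖

/-- the frame of the fjord family (without rows) [folklore] -/
theorem frame_Λ₂ : ∀ᶠ δ : ℝ in nhdsWithin 0 (Set.Ioi 0), hexDomainSimplyConnected (Λ₂ δ) ∧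
    aE δ ∈ hexDomainBoundary (Λ₂ δ) ∧ b₂ δ ∈ hexDomainBoundary (Λ₂ δ) ∧
    Nonempty (HexMidEdgeSAW (Λ₂ δ) (aE δ) (b₂ δ)) ∧
    (hexGraph.induce ((Λ₂ δ : Finset HexVertex) : Set HexVertex)).Preconnected ∧
    (∀ v ∈ Λ₂ δ, (δ : ℂ) * hexCenter v ∈ D₀.carrier) := by
  filter_upwards [Ioo_mem_nhdsGT (show (0:ℝ) < 1 / 100 by norm_num)] with δ hδ
  obtain ⟨hδ0, hδ1⟩ := hδ
  exact ⟨simplyConnected_Λ₂ hδ0 hδ1.le, aE_mem_boundary₂ hδ0 hδ1.le, b₂_mem_boundary hδ0 hδ1.le,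
    nonempty_saw_Λ₂ hδ0 hδ1.le, preconnected_Λ₂ hδ0 hδ1.le, inside_Λ₂ hδ0 hδ1.le⟩

/-- **The rows clause is load-bearing: `MassRatio` with the rows conjunct deleted is FALSE.**
Witness: `D₀`, `ρ = 1`, the fjord family `Λ₂`, `a_δ = aE δ`, `b'_δ = b₂ δ` (the corridor tip),
`K = Kbox`. Any proof of the crux must use the rows clause to exclude starvation of `b_δ`. [folklore] -/
theorem massRatio_false_without_rows : ¬ MassRatioWithoutRows := by
  intro h
  obtain ⟨C, hC⟩ := h D₀ 1 Λ₂ aE b₂ one_pos D₀_flat frame_Λ₂ (fun K hK hKD => exhaust_Λ₂ hK hKD)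
    tendsto_aE tendsto_b₂ Kbox Kbox_compact Kbox_sub
  exact Λ₂_violates C hC

/-- **`0 < ρ` is load-bearing: with `ρ = 0` the flatness and rows clauses are vacuous**, and the
same fjord family refutes the statement. [folklore] -/
theorem massRatio_false_without_rho_pos : ¬ MassRatioWithoutRhoPos := by
  intro h
  have hflat : D₀.carrier ∩ Metric.ball (D₀.pt 1) 0 =
      {z : ℂ | (D₀.pt 1).im < z.im} ∩ Metric.ball (D₀.pt 1) 0 := by simp
  have hframe : ∀ᶠ δ : ℝ in nhdsWithin 0 (Set.Ioi 0), hexDomainSimplyConnected (Λ₂ δ) ∧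
      aE δ ∈ hexDomainBoundary (Λ₂ δ) ∧ b₂ δ ∈ hexDomainBoundary (Λ₂ δ) ∧
      Nonempty (HexMidEdgeSAW (Λ₂ δ) (aE δ) (b₂ δ)) ∧
      (hexGraph.induce ((Λ₂ δ : Finset HexVertex) : Set HexVertex)).Preconnected ∧
      (∀ v ∈ Λ₂ δ, (δ : ℂ) * hexCenter v ∈ D₀.carrier) ∧
      (∀ v : HexVertex, (δ : ℂ) * hexCenter v ∈ Metric.ball (D₀.pt 1) 0 →
        (v ∈ Λ₂ δ ↔ mRow δ ≤ v.1 1)) := by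
    filter_upwards [frame_Λ₂] with δ hδ
    exact ⟨hδ.1, hδ.2.1, hδ.2.2.1, hδ.2.2.2.1, hδ.2.2.2.2.1, hδ.2.2.2.2.2, fun v hv => by simp at hv⟩
  obtain ⟨C, hC⟩ := h D₀ 0 Λ₂ mRow aE b₂ hflat hframe (fun K hK hKD => exhaust_Λ₂ hK hKD)
    tendsto_aE tendsto_b₂ Kbox Kbox_compact Kbox_sub
  exact Λ₂_violates C hC

end FjordFamily

end Summit.CriticalPhenomena.SAWScalingLimit.Theorems.MassRatio.Negative
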